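import Mathlib
import HarnessLib
import Summits.ResolutionOfSingularities.ResolutionOfSingularities.Theorems.HomologicalConductorPersistenceLatticeCasimir

/-!
# Crux `Persistence` (stmt-ResolutionOfSingularities-16484), chain W4.4b — R4-curve KEPT half at
# the `ca` level: `z^r ∈ ca²(A[z]/(z^{r+1}))` over every principal ideal domain `A`

Route `ResolutionOfSingularities/HomologicalConductor`.  OURS (cell res-hironaka, crux chain W4.4b,
`L/w44b/U12-SPEC.md` v2 §6 Cor. 2 as corrected by res-L1-w44b-tri-1's REFEREE-LemmaD
(«ca(k⟦t⟧[z]/z^{r+1}) = (z^r) for EVERY field»); seat res-D-pv-058, «U14» file 3); nothing here is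
a statement of the manuscript under review (Hironaka 2017); AI-written, weaker than expert review.

`A` a principal ideal domain (`K[t]`, `K⟦t⟧`, a field, …), `R` a commutative `A`-algebra with a
power basis `pb` and `pb.gen ^ pb.dim = 0` (`R ≅ A[z]/(z^{r+1})`, `r + 1 = dim`).

* `isTorsionFree_of_isSyzygy_one`, `free_of_isSyzygy_one` — a first syzygy module over `R`
  (kernel of a surjection from a finitely generated projective `R`-module) is, as an `A`-module,
  finitely generated and FREE: it embeds into some `Rᵐ`, which is free over `A`, and `A` is a PID.
* **`gen_pow_mem_cohomologyAnnihilatorOfDegree_two`** — **`z^{dim−1} ∈ ca²(R)`**: by CA1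
  (`mem_cohomologyAnnihilatorOfDegree_succ_iff_forall_isSyzygy`) it suffices that `z^{dim−1}` stably
  annihilates every first syzygy, which is a finitely generated free `A`-lattice, so
  `PersistenceLatticeCasimir.stablyAnnihilates_gen_pow_of_pid` (the idempotent Casimir certificate)
  applies — EVERY characteristic, no derivative; `gen_pow_mem_cohomologyAnnihilator` is the `ca` form.
  The Jacobian route (`PersistenceJacobianKept`) gives `dim • z^{dim−1} ∈ ca²`, which is this only
  when `dim` is invertible.

[folklore]/OURS; mechanism: Higman's criterion for the symmetric `A`-order `A[z]/(z^{r+1})`.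
-/

noncomputable section

-- single-problem summit: the doubled namespace component `ResolutionOfSingularities` is forced
set_option linter.dupNamespace false

open CategoryTheory Literature.RingTheory.CohomologyAnnihilator
open Summit.ResolutionOfSingularities.ResolutionOfSingularities.Theorems.NoZeno.SandwichCluster
open Summit.ResolutionOfSingularities.ResolutionOfSingularities.Theorems.HomologicalConductor.PersistenceLatticeCasimir

universe u v

namespace Summit.ResolutionOfSingularities.ResolutionOfSingularities.Theorems.HomologicalConductor.PersistenceLatticeKeptCa

variable {A : Type v} [CommRing A] {R : Type u} [CommRing R] [Algebra A R]

/-- A FIRST SYZYGY over an `A`-algebra `R` that is free as an `A`-module (power basis) is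
TORSION-FREE over the domain `A`: it embeds `R`-linearly into a finitely generated projective, hence
into some `Rᵐ`, which is free over `A`.  (The `A`-module structure on `K : ModuleCat R` is the
restriction of scalars.) [folklore] -/
theorem isTorsionFree_of_isSyzygy_one [IsDomain A] (pb : PowerBasis A R) {M K : ModuleCat.{u} R}
    (hK : IsSyzygy 1 M K) :
    letI : Module A K := Module.compHom K (algebraMap A R)
    Module.IsTorsionFree A K := by
  letI : Module A K := Module.compHom K (algebraMap A R)
  haveI : IsScalarTower A R K := IsScalarTower.of_algebraMap_smul fun _ _ => rfl
  obtain ⟨K', P, _, hPfin, hPproj, f, g, w, hS⟩ := hK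
  haveI := hPfin
  haveI := hPproj
  haveI : Module.Projective R P := P.projective_of_module_projective
  haveI : Module.Free A R := Module.Free.of_basis pb.basis
  obtain ⟨m, q, hq⟩ := Module.Finite.exists_fin' R P
  obtain ⟨s, hs⟩ := Module.projective_lifting_property q LinearMap.id hq
  have hsinj : Function.Injective s := LinearMap.injective_of_comp_eq_id s q hs
  have hfinj : Function.Injective f.hom := (ModuleCat.mono_iff_injective f).mp hS.mono_f
  refine Function.Injective.moduleIsTorsionFree (fun k => s (f.hom k)) (hsinj.comp hfinj)
    fun a k => ?_
  change s (f.hom (algebraMap A R a • k)) = a • s (f.hom k)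
  rw [map_smul, map_smul, algebraMap_smul]

/-- Over a principal ideal domain `A`, a first syzygy over `R` (free of finite rank over `A` via its
power basis) is a finitely generated FREE `A`-module. [folklore] -/
theorem free_of_isSyzygy_one [IsDomain A] [IsPrincipalIdealRing A] (pb : PowerBasis A R)
    {M K : ModuleCat.{u} R} (hM : Module.Finite R M) (hK : IsSyzygy 1 M K) :
    letI : Module A K := Module.compHom K (algebraMap A R)
    Module.Finite A K ∧ Module.Free A K := by
  letI : Module A K := Module.compHom K (algebraMap A R)
  haveI : IsScalarTower A R K := IsScalarTower.of_algebraMap_smul fun _ _ => rfl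
  haveI : Module.Finite A R := Module.Finite.of_basis pb.basis
  haveI : IsNoetherianRing R := IsNoetherianRing.of_finite A R
  haveI : Module.Finite R K := finite_of_isSyzygy 1 hM hK
  haveI : Module.Finite A K := Module.Finite.trans R K
  haveI : Module.IsTorsionFree A K := isTorsionFree_of_isSyzygy_one pb hK
  exact ⟨inferInstance, inferInstance⟩

/-- **`z^{dim−1} ∈ ca²(A[z]/(z^{dim}))` over every PID `A`, every characteristic.**  `R` a commutative
`A`-algebra with power basis `pb`, `pb.gen ^ pb.dim = 0`, `0 < pb.dim`, `A` a principal ideal domain: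
then `pb.gen ^ (pb.dim − 1) ∈ cohomologyAnnihilatorOfDegree R 2`.  Proof: CA1 reduces to the stable
annihilation of first syzygies, which are finitely generated free `A`-lattices
(`free_of_isSyzygy_one`), where the idempotent Casimir certificate
`PersistenceLatticeCasimir.stablyAnnihilates_gen_pow_of_pid` applies.  (The KEPT half of
«`ca(K⟦t⟧[z]/z^{r+1}) = (z^r)`», U12-SPEC §6 Cor. 2 as corrected by res-L1-w44b-tri-1: no `∂_z`, so
the primes dividing `r + 1` are included.) [OURS] -/
theorem gen_pow_mem_cohomologyAnnihilatorOfDegree_two [IsDomain A] [IsPrincipalIdealRing A]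
    (pb : PowerBasis A R) (hnil : pb.gen ^ pb.dim = 0) (hd : 0 < pb.dim) :
    pb.gen ^ (pb.dim - 1) ∈ cohomologyAnnihilatorOfDegree R 2 := by
  haveI : Module.Finite A R := Module.Finite.of_basis pb.basis
  haveI : IsNoetherianRing R := IsNoetherianRing.of_finite A R
  rw [show (2 : ℕ) = 1 + 1 from rfl, mem_cohomologyAnnihilatorOfDegree_succ_iff_forall_isSyzygy]
  intro M K hM hK
  letI : Module A K := Module.compHom K (algebraMap A R)
  haveI : IsScalarTower A R K := IsScalarTower.of_algebraMap_smul fun _ _ => rfl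
  obtain ⟨hfin, hfree⟩ := free_of_isSyzygy_one pb hM hK
  haveI := hfin
  haveI := hfree
  exact stablyAnnihilates_gen_pow_of_pid pb hnil hd

/-- `ca`-form: `z^{dim−1} ∈ ca(R)` (`R ≅ A[z]/(z^{dim})`, `A` a PID). [OURS] -/
theorem gen_pow_mem_cohomologyAnnihilator [IsDomain A] [IsPrincipalIdealRing A]
    (pb : PowerBasis A R) (hnil : pb.gen ^ pb.dim = 0) (hd : 0 < pb.dim) :
    pb.gen ^ (pb.dim - 1) ∈ cohomologyAnnihilator R :=
  cohomologyAnnihilatorOfDegree_le 2 (gen_pow_mem_cohomologyAnnihilatorOfDegree_two pb hnil hd)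

/-- The ideal form: `(z^{dim−1}) ≤ ca²(R)`. [OURS] -/
theorem span_gen_pow_le_cohomologyAnnihilatorOfDegree_two [IsDomain A] [IsPrincipalIdealRing A]
    (pb : PowerBasis A R) (hnil : pb.gen ^ pb.dim = 0) (hd : 0 < pb.dim) :
    Ideal.span {pb.gen ^ (pb.dim - 1)} ≤ cohomologyAnnihilatorOfDegree R 2 := by
  rw [Ideal.span_le, Set.singleton_subset_iff]
  exact gen_pow_mem_cohomologyAnnihilatorOfDegree_two pb hnil hd

end Summit.ResolutionOfSingularities.ResolutionOfSingularities.Theorems.HomologicalConductor.PersistenceLatticeKeptCa
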